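import Mathlib
import Summits.Ventures.PercRepro2.ExplorationTree
import Summits.Ventures.PercRepro2.EdgeSplit

/-!
# The leaf of a stopping exploration as a sub-σ-algebra: the conditional expectation given an
exploration tree is the pinned expectation at its leaf (blind cell PercRepro2, typer-1 g19; a
language line)

`ExplorationCondExp.lean` stated the domain Markov property for a FIXED explored set `F`:
`μ_p[f | σ(ω_e : e ∈ F)] =ᵐ exploredMean p F f`.  Here the explored set is ADAPTIVE: an
exploration tree `t : ETree E` (`ExplorationTree.lean`) reveals one edge at a time, the next edge
depending on what was seen, and stops at a leaf `ℓ : Partial E`.  The leaf reached by a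
configuration `ω` is `leafOf t root ω`; the σ-algebra of the exploration is
`leafSigma t = comap (leafOf t root) ⊤` — the σ-algebra whose atoms are the leaf events, which
partition `Config E` when `t` is valid.

* `leafOf`: follow the tree, reading each revealed edge in `ω`; `leafOf_mem_leaves`,
  `mem_event_leafOf` (a configuration lies in the event of its own leaf), `leafOf_eq_of_mem_event`
  (for a valid tree the leaf events are the fibres of `leafOf`);
* `expect_indicator_preimage_leafOf`: an expectation over a preimage set of the leaf map is a sum
  over the leaves; `expect_eq_sum_leaves_pin`: the leaf decomposition
  `E_p f = Σ_{ℓ ∈ leaves t root} P_p(ℓ) · E_{pin p ℓ} f` (over any commutative ring);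
* `leafMean p t f ω = E_{pin p (leafOf t root ω)} f` — the pinned mean at the leaf reached;
* **`condExp_leafSigma`**: `μ_p[f | leafSigma t] =ᵐ leafMean p t f` for EVERY weight vector and
  every valid tree — the conditional expectation given a stopping exploration IS the pinned
  expectation at its leaf (the strong Markov property of the exploration process in `condExp`
  form; `ae_eq_condExp_of_forall_setIntegral_eq` on the preimage sets of the leaf map, each a
  disjoint union of leaf events, `expect_mul_indicator_event` per leaf);
* `expect_leafMean`: the disintegration `E_p f = E_p[ω ↦ E_{pin p (leafOf t root ω)} f]`;
* `cond_percMeasureOf_event` / `integral_cond_event`: conditioning Mathlib's measure on a partial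
  configuration IS pinning (`(percMeasureOf p hp)[|P.event] = percMeasureOf (pin p P)` for
  `P_p(P.event) ≠ 0`; `pin p P = condWeights p P.F P.σ` definitionally, `pin_eq_condWeights`).

Identities only; nothing about the sign of any term.
-/

namespace Summit.Ventures.PercRepro2

open MeasureTheory ProbabilityTheory MeasureBridge

namespace ExplorationTree

/-! ## The leaf reached by a configuration -/

section Leaf

variable {E : Type*} [DecidableEq E]

/-- The leaf reached by the configuration `ω` from the partial configuration `P`: follow the tree,
reading each revealed edge in `ω`. -/
def leafOf : ETree E → Partial E → Config E → Partial E
  | .leaf, P, _ => P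
  | .node e t₀ t₁, P, ω =>
      if ω e then leafOf t₁ (P.extend e true) ω else leafOf t₀ (P.extend e false) ω

/-- `leafOf` at a leaf. -/
@[simp] lemma leafOf_leaf (P : Partial E) (ω : Config E) : leafOf .leaf P ω = P := rfl

/-- `leafOf` at a node: read the revealed edge. -/
lemma leafOf_node (e : E) (t₀ t₁ : ETree E) (P : Partial E) (ω : Config E) :
    leafOf (.node e t₀ t₁) P ω =
      if ω e then leafOf t₁ (P.extend e true) ω else leafOf t₀ (P.extend e false) ω := rfl

/-- The leaf reached is one of the leaves. -/
lemma leafOf_mem_leaves (t : ETree E) :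
    ∀ (P : Partial E) (ω : Config E), leafOf t P ω ∈ leaves t P := by
  induction t with
  | leaf =>
    intro P ω
    simp [leaves]
  | node e t₀ t₁ ih₀ ih₁ =>
    intro P ω
    rw [leafOf_node]
    simp only [leaves, List.mem_append]
    by_cases hωe : ω e = true
    · rw [if_pos hωe]
      exact Or.inr (ih₁ _ _)
    · rw [if_neg hωe]
      exact Or.inl (ih₀ _ _)

/-- The events of the leaves of a valid tree lie inside the event of its root. -/
lemma event_subset_of_mem_leaves (t : ETree E) :
    ∀ (P : Partial E), Valid t P.F → ∀ ℓ ∈ leaves t P, ℓ.event ⊆ P.event := by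
  induction t with
  | leaf =>
    intro P _ ℓ hℓ
    simp only [leaves, List.mem_singleton] at hℓ
    rw [hℓ]
  | node e t₀ t₁ ih₀ ih₁ =>
    intro P hv ℓ hℓ
    obtain ⟨he, hv₀, hv₁⟩ := hv
    simp only [leaves, List.mem_append] at hℓ
    rcases hℓ with hℓ | hℓ
    · refine (ih₀ _ hv₀ ℓ hℓ).trans ?_
      rw [extend_event_false P he]
      exact Set.inter_subset_left
    · refine (ih₁ _ hv₁ ℓ hℓ).trans ?_
      rw [extend_event_true P he]
      exact Set.inter_subset_left

/-- A configuration in the root event lies in the event of the leaf it reaches. -/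
lemma mem_event_leafOf (t : ETree E) :
    ∀ (P : Partial E), Valid t P.F → ∀ ω ∈ P.event, ω ∈ (leafOf t P ω).event := by
  induction t with
  | leaf =>
    intro P _ ω hω
    exact hω
  | node e t₀ t₁ ih₀ ih₁ =>
    intro P hv ω hω
    obtain ⟨he, hv₀, hv₁⟩ := hv
    rw [leafOf_node]
    by_cases hωe : ω e = true
    · rw [if_pos hωe]
      refine ih₁ _ hv₁ ω ?_
      rw [extend_event_true P he]
      exact ⟨hω, hωe⟩
    · rw [if_neg hωe]
      refine ih₀ _ hv₀ ω ?_
      rw [extend_event_false P he]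
      exact ⟨hω, by simpa using hωe⟩

/-- On the event of a leaf of a valid tree the leaf reached is that leaf: the leaf events are the
fibres of `leafOf`. -/
lemma leafOf_eq_of_mem_event (t : ETree E) :
    ∀ (P : Partial E), Valid t P.F → ∀ ℓ ∈ leaves t P, ∀ ω ∈ ℓ.event, leafOf t P ω = ℓ := by
  induction t with
  | leaf =>
    intro P _ ℓ hℓ ω _
    simp only [leaves, List.mem_singleton] at hℓ
    rw [leafOf_leaf, hℓ]
  | node e t₀ t₁ ih₀ ih₁ =>
    intro P hv ℓ hℓ ω hω
    obtain ⟨he, hv₀, hv₁⟩ := hv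
    simp only [leaves, List.mem_append] at hℓ
    rw [leafOf_node]
    rcases hℓ with hℓ | hℓ
    · have hω' := event_subset_of_mem_leaves t₀ _ hv₀ ℓ hℓ hω
      rw [extend_event_false P he] at hω'
      have h2 : ω e = false := hω'.2
      rw [if_neg (by simp [h2])]
      exact ih₀ _ hv₀ ℓ hℓ ω hω
    · have hω' := event_subset_of_mem_leaves t₁ _ hv₁ ℓ hℓ hω
      rw [extend_event_true P he] at hω'
      have h2 : ω e = true := hω'.2
      rw [if_pos h2]
      exact ih₁ _ hv₁ ℓ hℓ ω hω

end Leaf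

/-! ## Expectations over preimage sets of the leaf map -/

section Sum

variable {E : Type*} [Fintype E] [DecidableEq E] {R : Type*} [CommRing R]

/-- `E_p[1_ℰ f] = P_p(ℰ) · E_{pin p ℰ} f` (`expect_mul_indicator_event` in indicator form). -/
lemma expect_indicator_event (p : E → R) (P : Partial E) (f : Config E → R) :
    expect p (P.event.indicator f) = prob p P.event * expect (pin p P) f := by
  have h : P.event.indicator f = fun ω => f ω * P.event.indicator 1 ω := by
    funext ω
    by_cases hω : ω ∈ P.event <;> simp [hω]
  rw [h, expect_mul_indicator_event]

omit [Fintype E] in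
/-- The two branches of a node reach disjoint parts of the root event. -/
lemma disjoint_branches (t₀ t₁ : ETree E) (P : Partial E) {e : E} (he : e ∉ P.F)
    (T : Set (Partial E)) :
    Disjoint (leafOf t₀ (P.extend e false) ⁻¹' T ∩ (P.extend e false).event)
      (leafOf t₁ (P.extend e true) ⁻¹' T ∩ (P.extend e true).event) := by
  rw [extend_event_false P he, extend_event_true P he]
  refine Set.disjoint_left.mpr fun ω h0 h1 => ?_
  have a : ω e = false := h0.2.2
  have b : ω e = true := h1.2.2
  rw [a] at b
  exact Bool.false_ne_true b

omit [Fintype E] in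
/-- A preimage set of the leaf map at a node splits along the revealed edge. -/
lemma preimage_leafOf_node (t₀ t₁ : ETree E) (P : Partial E) {e : E} (he : e ∉ P.F)
    (T : Set (Partial E)) :
    leafOf (.node e t₀ t₁) P ⁻¹' T ∩ P.event =
      (leafOf t₀ (P.extend e false) ⁻¹' T ∩ (P.extend e false).event) ∪
        (leafOf t₁ (P.extend e true) ⁻¹' T ∩ (P.extend e true).event) := by
  rw [extend_event_false P he, extend_event_true P he]
  ext ω
  simp only [Set.mem_inter_iff, Set.mem_preimage, Set.mem_union, leafOf_node, mem_openEdge,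
    mem_closedEdge]
  by_cases hωe : ω e = true
  · simp [hωe]
  · have h2 : ω e = false := by simpa using hωe
    simp [h2]

open scoped Classical in
/-- An expectation over a preimage set of the leaf map (inside the root event) is a sum over the
leaves. -/
lemma expect_indicator_preimage_leafOf (p : E → R) (t : ETree E) :
    ∀ (P : Partial E), Valid t P.F → ∀ (T : Set (Partial E)) (h : Config E → R),
      expect p ((leafOf t P ⁻¹' T ∩ P.event).indicator h) =
        ((leaves t P).map fun ℓ => if ℓ ∈ T then expect p (ℓ.event.indicator h) else 0).sum := by
  induction t with
  | leaf =>
    intro P _ T h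
    simp only [leaves, List.map_cons, List.map_nil, List.sum_cons, List.sum_nil, add_zero]
    by_cases hP : P ∈ T
    · rw [if_pos hP]
      congr 1
      have : leafOf .leaf P ⁻¹' T ∩ P.event = P.event := by
        ext ω
        simp [hP]
      rw [this]
    · rw [if_neg hP]
      have : leafOf .leaf P ⁻¹' T ∩ P.event = ∅ := by
        ext ω
        simp [hP]
      rw [this, Set.indicator_empty]
      simp [expect]
  | node e t₀ t₁ ih₀ ih₁ =>
    intro P hv T h
    obtain ⟨he, hv₀, hv₁⟩ := hv
    simp only [leaves, List.map_append, List.sum_append]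
    rw [← ih₀ (P.extend e false) hv₀ T h, ← ih₁ (P.extend e true) hv₁ T h,
      preimage_leafOf_node t₀ t₁ P he T, Set.indicator_union_of_disjoint (disjoint_branches t₀ t₁ P he T)]
    exact expect_add p _ _

/-- **The leaf decomposition of an expectation**:
`E_p f = Σ_{ℓ ∈ leaves t root} P_p(ℓ) · E_{pin p ℓ} f`. -/
theorem expect_eq_sum_leaves_pin (p : E → R) (t : ETree E) (hv : Valid t ∅) (f : Config E → R) :
    expect p f = ((leaves t root).map fun ℓ => prob p ℓ.event * expect (pin p ℓ) f).sum := by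
  classical
  have h := expect_indicator_preimage_leafOf p t root hv Set.univ f
  rw [Set.preimage_univ, root_event, Set.univ_inter, Set.indicator_univ] at h
  rw [h]
  congr 1
  refine List.map_congr_left fun ℓ _ => ?_
  rw [if_pos (Set.mem_univ ℓ), expect_indicator_event]

omit [Fintype E] in
/-- `pin` is `condWeights` on the explored set. -/
lemma pin_eq_condWeights (p : E → R) (P : Partial E) :
    pin p P = CylinderCond.condWeights p P.F P.σ := rfl

end Sum

/-! ## The σ-algebra of a stopping exploration and the conditional expectation -/

section CondExp

variable {E : Type*} [Fintype E] [DecidableEq E]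

/-- The σ-algebra of the exploration `t`: generated by the leaf map from the root
(`σ(leafOf t root)`; its atoms are the leaf events). -/
abbrev leafSigma (t : ETree E) : MeasurableSpace (Config E) :=
  MeasurableSpace.comap (leafOf t root) (⊤ : MeasurableSpace (Partial E))

/-- The σ-algebra of the exploration is coarser than the product σ-algebra. -/
lemma leafSigma_le (t : ETree E) :
    leafSigma t ≤ (inferInstance : MeasurableSpace (Config E)) := by
  rintro s ⟨T, -, rfl⟩
  exact MeasurableSet.of_discrete

omit [Fintype E] in
/-- For a valid tree the event of a leaf is the fibre of the leaf map over it. -/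
lemma event_eq_preimage_singleton (t : ETree E) (hv : Valid t ∅) {ℓ : Partial E}
    (hℓ : ℓ ∈ leaves t root) : ℓ.event = leafOf t root ⁻¹' {ℓ} := by
  ext ω
  constructor
  · intro hω
    exact leafOf_eq_of_mem_event t root hv ℓ hℓ ω hω
  · intro hω
    have h1 : ω ∈ (leafOf t root ω).event :=
      mem_event_leafOf t root hv ω (by rw [root_event]; trivial)
    have h2 : leafOf t root ω = ℓ := hω
    rwa [h2] at h1

omit [Fintype E] in
/-- A preimage set of the leaf map is the union of the leaf events it contains. -/
lemma preimage_leafOf_eq_biUnion (t : ETree E) (hv : Valid t ∅) (T : Set (Partial E)) :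
    leafOf t root ⁻¹' T = ⋃ ℓ ∈ {ℓ | ℓ ∈ leaves t root ∧ ℓ ∈ T}, ℓ.event := by
  ext ω
  simp only [Set.mem_preimage, Set.mem_iUnion, Set.mem_setOf_eq, exists_prop]
  constructor
  · intro hT
    exact ⟨leafOf t root ω, ⟨leafOf_mem_leaves t root ω, hT⟩,
      mem_event_leafOf t root hv ω (by rw [root_event]; trivial)⟩
  · rintro ⟨ℓ, ⟨hℓ, hT⟩, hω⟩
    rw [leafOf_eq_of_mem_event t root hv ℓ hℓ ω hω]
    exact hT

omit [Fintype E] in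
/-- **The σ-algebra of a valid exploration is generated by its leaf events** (an intrinsic
description: no leaf map). -/
theorem leafSigma_eq_generateFrom (t : ETree E) (hv : Valid t ∅) :
    leafSigma t = MeasurableSpace.generateFrom {s | ∃ ℓ ∈ leaves t root, s = ℓ.event} := by
  apply le_antisymm
  · rintro s ⟨T, -, rfl⟩
    rw [preimage_leafOf_eq_biUnion t hv T]
    refine Set.Finite.measurableSet_biUnion ((List.finite_toSet _).subset fun ℓ hℓ => hℓ.1)
      fun ℓ hℓ => MeasurableSpace.measurableSet_generateFrom ⟨ℓ, hℓ.1, rfl⟩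
  · refine MeasurableSpace.generateFrom_le ?_
    rintro s ⟨ℓ, hℓ, rfl⟩
    rw [event_eq_preimage_singleton t hv hℓ]
    exact ⟨{ℓ}, trivial, rfl⟩

/-- The pinned mean at the leaf reached: `ω ↦ E_{pin p (leafOf t root ω)} f`. -/
noncomputable def leafMean (p : E → ℝ) (t : ETree E) (f : Config E → ℝ) : Config E → ℝ :=
  fun ω => expect (pin p (leafOf t root ω)) f

/-- `leafMean` factors through the leaf map. -/
lemma leafMean_eq_comp (p : E → ℝ) (t : ETree E) (f : Config E → ℝ) :
    leafMean p t f = (fun ℓ => expect (pin p ℓ) f) ∘ leafOf t root := rfl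

/-- On the event of a leaf of a valid tree the pinned mean is constant:
`E_p[1_ℓ · leafMean p t f] = P_p(ℓ) · E_{pin p ℓ} f`. -/
lemma expect_indicator_event_leafMean (p : E → ℝ) (t : ETree E) (hv : Valid t ∅)
    (f : Config E → ℝ) {ℓ : Partial E} (hℓ : ℓ ∈ leaves t root) :
    expect p (ℓ.event.indicator (leafMean p t f)) = prob p ℓ.event * expect (pin p ℓ) f := by
  have h : ℓ.event.indicator (leafMean p t f) = ℓ.event.indicator (fun _ => expect (pin p ℓ) f) :=
    Set.indicator_congr fun ω hω => by
      simp only [leafMean]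
      rw [leafOf_eq_of_mem_event t root hv ℓ hℓ ω hω]
  rw [h, expect_indicator_event, expect_const]

/-- **The conditional expectation given a stopping exploration is the pinned expectation at its
leaf**: `μ_p[f | leafSigma t] =ᵐ leafMean p t f`, for every weight vector and every valid tree. -/
theorem condExp_leafSigma (p : E → ℝ) (hp : IsProbVec p) (t : ETree E) (hv : Valid t ∅)
    (f : Config E → ℝ) :
    (percMeasureOf p hp)[f | leafSigma t] =ᵐ[percMeasureOf p hp] leafMean p t f := by
  classical
  refine (ae_eq_condExp_of_forall_setIntegral_eq (leafSigma_le t) Integrable.of_finite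
    (fun _ _ _ => Integrable.of_finite.integrableOn) ?_ ?_).symm
  · intro s hs _
    obtain ⟨T, -, rfl⟩ := hs
    rw [← integral_indicator MeasurableSet.of_discrete, ← integral_indicator MeasurableSet.of_discrete,
      integral_percMeasureOf, integral_percMeasureOf]
    have e1 : leafOf t root ⁻¹' T = leafOf t root ⁻¹' T ∩ root.event := by
      rw [root_event, Set.inter_univ]
    rw [e1, expect_indicator_preimage_leafOf p t root hv, expect_indicator_preimage_leafOf p t root hv]
    congr 1
    refine List.map_congr_left fun ℓ hℓ => ?_
    by_cases hT : ℓ ∈ T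
    · rw [if_pos hT, if_pos hT, expect_indicator_event_leafMean p t hv f hℓ, expect_indicator_event]
    · rw [if_neg hT, if_neg hT]
  · rw [leafMean_eq_comp]
    exact (measurable_from_top.comp (comap_measurable (m := ⊤) (leafOf t root))).stronglyMeasurable
      |>.aestronglyMeasurable

/-- **Disintegration over a stopping exploration**:
`E_p f = E_p[ω ↦ E_{pin p (leafOf t root ω)} f]`. -/
theorem expect_leafMean (p : E → ℝ) (hp : IsProbVec p) (t : ETree E) (hv : Valid t ∅)
    (f : Config E → ℝ) : expect p (leafMean p t f) = expect p f := by
  rw [← integral_percMeasureOf p hp, ← integral_percMeasureOf p hp,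
    ← integral_congr_ae (condExp_leafSigma p hp t hv f), integral_condExp (leafSigma_le t)]

/-- **Conditioning on a partial configuration is pinning**, at Mathlib's measure level: for
`P_p(P.event) ≠ 0`, `(percMeasureOf p hp)[|P.event] = percMeasureOf (pin p P)`
(`EdgeSplit.cond_percMeasureOf_cylinder` read through `pin_eq_condWeights`). -/
theorem cond_percMeasureOf_event (p : E → ℝ) (hp : IsProbVec p) (P : Partial E)
    (hP : prob p P.event ≠ 0) :
    (percMeasureOf p hp)[|P.event] = percMeasureOf (pin p P) (isProbVec_pin hp P) :=
  EdgeSplit.cond_percMeasureOf_cylinder p hp P.F P.σ hP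

/-- `∫ f ∂μ_p[|P.event] = E_{pin p P} f` for `P_p(P.event) ≠ 0`. -/
theorem integral_cond_event (p : E → ℝ) (hp : IsProbVec p) (P : Partial E)
    (hP : prob p P.event ≠ 0) (f : Config E → ℝ) :
    ∫ ω, f ω ∂((percMeasureOf p hp)[|P.event]) = expect (pin p P) f := by
  rw [cond_percMeasureOf_event p hp P hP, integral_percMeasureOf]

end CondExp

end ExplorationTree

end Summit.Ventures.PercRepro2
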